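import Mathlib
import Summits.ValiantsHypothesis.ValiantsHypothesis.Theorems.DivisionGapShadowBirkhoffCounterDefs

/-!
# `stub_transfer` — counter + flow formulation ⇒ `2^K` lower vertices (line `Sketch-ideator4`)

Registered stub `stub_transfer` of the crux skeleton of `DivisionGap.ShadowBirkhoff`
(stmt-ValiantsHypothesis-5069), line `Sketch-ideator4` (ternary two-polarity cut counter ⇒ flow-extended
formulation).  Margin argument: near each supporting integer slope `μ_D` of the counter (strict integer
inequalities have gap `≥ 1`, abscissae are bounded by `3^K`, so the window `|μ − μ_D| ≤ 1/(4·3^K)` keeps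
`(D, D)` the minimiser) the parametric value `counterVal K` is affine with slope `−X2 D D`; by the flow
formulation so is `patternVal` (slope `d − X2 D D`), hence every point of the value set that is active at
`μ_D` is the single point `(X2 D D − d, Y4 D D + c)`, which is therefore a lower vertex; distinct `D` give
distinct abscissae because the ternary digit sum `sdot` is injective.
-/

set_option linter.dupNamespace false

noncomputable section

open scoped BigOperators

namespace Summit.ValiantsHypothesis.ValiantsHypothesis.Theorems.DivisionGapShadowBirkhoff

/-! ## Ternary digit sums -/

/-- Ternary digit sums are nonnegative. [folklore] -/
theorem transfer_sdot_nonneg {K : ℕ} (α : Fin K → Bool) : 0 ≤ sdot α := by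
  unfold sdot
  exact Finset.sum_nonneg fun i _ => by split_ifs <;> positivity

/-- Peeling off the top ternary digit. [folklore] -/
theorem transfer_sdot_succ {K : ℕ} (α : Fin (K + 1) → Bool) :
    sdot α = sdot (α ∘ Fin.castSucc) + if α (Fin.last K) then (3 : ℤ) ^ K else 0 := by
  unfold sdot
  rw [Fin.sum_univ_castSucc]
  rfl

/-- A ternary `0/1`-digit sum with `K` digits is at most `(3^K − 1)/2`. [folklore] -/
theorem transfer_two_sdot_lt : ∀ {K : ℕ} (α : Fin K → Bool), 2 * sdot α + 1 ≤ 3 ^ K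
  | 0, α => by simp [sdot]
  | K + 1, α => by
    rw [transfer_sdot_succ, pow_succ]
    have ih := transfer_two_sdot_lt (α ∘ Fin.castSucc)
    have h3 : (0 : ℤ) ≤ 3 ^ K := by positivity
    split_ifs <;> linarith

/-- Ternary `0/1`-digit sums determine the digits. [folklore] -/
theorem transfer_sdot_injective : ∀ {K : ℕ} (α β : Fin K → Bool), sdot α = sdot β → α = β
  | 0, α, β, _ => funext fun i => Fin.elim0 i
  | K + 1, α, β, h => by
    rw [transfer_sdot_succ α, transfer_sdot_succ β] at h
    have hα := transfer_two_sdot_lt (α ∘ Fin.castSucc)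
    have hβ := transfer_two_sdot_lt (β ∘ Fin.castSucc)
    have hα0 := transfer_sdot_nonneg (α ∘ Fin.castSucc)
    have hβ0 := transfer_sdot_nonneg (β ∘ Fin.castSucc)
    obtain ⟨hlast, hinit⟩ : α (Fin.last K) = β (Fin.last K) ∧
        sdot (α ∘ Fin.castSucc) = sdot (β ∘ Fin.castSucc) := by
      cases ha : α (Fin.last K) <;> cases hb : β (Fin.last K) <;>
        simp only [ha, hb, Bool.false_eq_true, if_false, if_true, add_zero] at h <;>
        refine ⟨?_, ?_⟩ <;> first | rfl | linarith
    have hcomp : α ∘ Fin.castSucc = β ∘ Fin.castSucc := transfer_sdot_injective _ _ hinit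
    funext i
    induction i using Fin.lastCases with
    | last => exact hlast
    | cast j => exact congrFun hcomp j

/-- Differences of abscissae `X2` are bounded by `3^K`. [folklore] -/
theorem transfer_abs_X2_sub_le {K : ℕ} (α β γ δ : Fin K → Bool) :
    |(X2 α β : ℝ) - X2 γ δ| ≤ 3 ^ K := by
  have h1 : 2 * (sdot α : ℝ) + 1 ≤ 3 ^ K := by exact_mod_cast transfer_two_sdot_lt α
  have h2 : 2 * (sdot β : ℝ) + 1 ≤ 3 ^ K := by exact_mod_cast transfer_two_sdot_lt β
  have h3 : 2 * (sdot γ : ℝ) + 1 ≤ 3 ^ K := by exact_mod_cast transfer_two_sdot_lt γ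
  have h4 : 2 * (sdot δ : ℝ) + 1 ≤ 3 ^ K := by exact_mod_cast transfer_two_sdot_lt δ
  have h5 : (0 : ℝ) ≤ sdot α := by exact_mod_cast transfer_sdot_nonneg α
  have h6 : (0 : ℝ) ≤ sdot β := by exact_mod_cast transfer_sdot_nonneg β
  have h7 : (0 : ℝ) ≤ sdot γ := by exact_mod_cast transfer_sdot_nonneg γ
  have h8 : (0 : ℝ) ≤ sdot δ := by exact_mod_cast transfer_sdot_nonneg δ
  unfold X2
  push_cast
  rw [abs_le]
  constructor <;> linarith

/-! ## The counter's parametric value near a supporting slope -/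

/-- **Margin lemma.**  If `(D, D)` is the strict minimiser of `Y4 − m·X2` for an integer slope `m`, then
on the window `|μ − m| ≤ 1/(4·3^K)` the counter's parametric value is the affine function
`Y4 D D − μ·X2 D D` (integer gap `≥ 1` against abscissa differences `≤ 3^K`). [folklore] -/
theorem transfer_counterVal_eq {K : ℕ} (D : Fin K → Bool) (m : ℤ)
    (hm : ∀ α β : Fin K → Bool, (α, β) ≠ (D, D) → Y4 D D - m * X2 D D < Y4 α β - m * X2 α β)
    (μ : ℝ) (hμ : |μ - m| ≤ 1 / (4 * 3 ^ K)) :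
    counterVal K μ = (Y4 D D : ℝ) - μ * (X2 D D : ℝ) := by
  apply le_antisymm
  · exact ciInf_le (Set.finite_range _).bddBelow ((D, D) : (Fin K → Bool) × (Fin K → Bool))
  · apply le_ciInf
    rintro ⟨α, β⟩
    dsimp only
    by_cases hne : (α, β) = (D, D)
    · obtain ⟨rfl, rfl⟩ := Prod.mk.inj hne
      exact le_rfl
    · have hgap : Y4 D D - m * X2 D D + 1 ≤ Y4 α β - m * X2 α β := hm α β hne
      have hgapR : (Y4 D D : ℝ) - m * X2 D D + 1 ≤ Y4 α β - m * X2 α β := by exact_mod_cast hgap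
      have hX : |(X2 α β : ℝ) - X2 D D| ≤ 3 ^ K := transfer_abs_X2_sub_le α β D D
      have hprod : |(μ - m) * ((X2 α β : ℝ) - X2 D D)| ≤ 1 / (4 * 3 ^ K) * 3 ^ K := by
        rw [abs_mul]
        exact mul_le_mul hμ hX (abs_nonneg _) (by positivity)
      have h14 : (1 : ℝ) / (4 * 3 ^ K) * 3 ^ K = 1 / 4 := by
        field_simp
      rw [h14] at hprod
      have hup := (abs_le.1 hprod).2
      have key : (Y4 α β : ℝ) - μ * X2 α β - ((Y4 D D : ℝ) - μ * X2 D D)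
          = ((Y4 α β : ℝ) - m * X2 α β - ((Y4 D D : ℝ) - m * X2 D D))
            - (μ - m) * ((X2 α β : ℝ) - X2 D D) := by ring
      rw [← sub_nonneg, key]
      linarith

/-! ## The pattern's value set -/

section pattern

variable {N : ℕ} (G : Finset (Fin N × Fin N)) (wb wa : Fin N → Fin N → ℝ)

/-- The value set of a weighted pattern is finite. [folklore] -/
theorem transfer_valueSet_finite : (valueSet G wb wa).Finite := by
  apply (Set.finite_range (fun ρ : Equiv.Perm (Fin N) => (∑ u, wb u (ρ u), ∑ u, wa u (ρ u)))).subset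
  rintro q ⟨ρ, -, rfl⟩
  exact ⟨ρ, rfl⟩

/-- The parametric value is a lower bound for `q.2 − μ·q.1` over the value set. [folklore] -/
theorem transfer_patternVal_le (μ : ℝ) {q : ℝ × ℝ} (hq : q ∈ valueSet G wb wa) :
    patternVal G wb wa μ ≤ q.2 - μ * q.1 := by
  obtain ⟨ρ, hρ, rfl⟩ := hq
  exact ciInf_le (Set.finite_range _).bddBelow
    (⟨ρ, hρ⟩ : {ρ : Equiv.Perm (Fin N) // ∀ u, (u, ρ u) ∈ G})

/-- If some permutation is supported in the pattern, the parametric value is attained on the value set.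
[folklore] -/
theorem transfer_exists_active (hne : ∃ ρ : Equiv.Perm (Fin N), ∀ u, (u, ρ u) ∈ G) (μ : ℝ) :
    ∃ q ∈ valueSet G wb wa, q.2 - μ * q.1 = patternVal G wb wa μ := by
  obtain ⟨ρ₀, hρ₀⟩ := hne
  haveI : Nonempty {ρ : Equiv.Perm (Fin N) // ∀ u, (u, ρ u) ∈ G} := ⟨⟨ρ₀, hρ₀⟩⟩
  obtain ⟨ρ, hρ⟩ := exists_eq_ciInf_of_finite
    (f := fun ρ : {ρ : Equiv.Perm (Fin N) // ∀ u, (u, ρ u) ∈ G} =>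
      (∑ u, wa u (ρ.1 u)) - μ * ∑ u, wb u (ρ.1 u))
  exact ⟨(∑ u, wb u (ρ.1 u), ∑ u, wa u (ρ.1 u)), ⟨ρ.1, ρ.2, rfl⟩, hρ⟩

/-- **Active points under a two-sided affine window.**  If the parametric value is the affine function
`μ ↦ a − μ·x` on a window `|μ − m| ≤ t`, `t > 0`, then every point `q` of the value set with
`q.2 − m·q.1 ≤ a − m·x` is the point `(x, a)`. [folklore] -/
theorem transfer_active_eq (m t x a : ℝ) (ht : 0 < t)
    (haff : ∀ μ, |μ - m| ≤ t → patternVal G wb wa μ = a - μ * x)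
    {q : ℝ × ℝ} (hq : q ∈ valueSet G wb wa) (hle : q.2 - m * q.1 ≤ a - m * x) : q = (x, a) := by
  have h1 := transfer_patternVal_le G wb wa (m + t) hq
  have h2 := transfer_patternVal_le G wb wa (m - t) hq
  have h0 := transfer_patternVal_le G wb wa m hq
  rw [haff (m + t) (by rw [add_sub_cancel_left, abs_of_pos ht])] at h1
  rw [haff (m - t) (by rw [sub_sub_cancel_left, abs_neg, abs_of_pos ht])] at h2
  rw [haff m (by simp [ht.le])] at h0
  have hx1 : t * q.1 ≤ t * x := by linarith
  have hx2 : t * x ≤ t * q.1 := by linarith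
  have hx : q.1 = x := le_antisymm (le_of_mul_le_mul_left hx1 ht) (le_of_mul_le_mul_left hx2 ht)
  refine Prod.ext hx ?_
  rw [hx] at h0 hle
  show q.2 = a
  linarith

/-- **Lower vertex from an affine window.**  Under the hypotheses of `transfer_active_eq` and if some
permutation is supported in the pattern, `(x, a)` is a lower vertex of the value set (it is the unique
active point at slope `m`). [folklore] -/
theorem transfer_mem_lowerVertices (hne : ∃ ρ : Equiv.Perm (Fin N), ∀ u, (u, ρ u) ∈ G)
    (m t x a : ℝ) (ht : 0 < t) (haff : ∀ μ, |μ - m| ≤ t → patternVal G wb wa μ = a - μ * x) :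
    (x, a) ∈ lowerVertices (valueSet G wb wa) := by
  have hval : patternVal G wb wa m = a - m * x := haff m (by simp [ht.le])
  refine ⟨?_, m, fun q hq hqne => ?_⟩
  · obtain ⟨q, hq, hact⟩ := transfer_exists_active G wb wa hne m
    have := transfer_active_eq G wb wa m t x a ht haff hq (by rw [hact, hval])
    rwa [this] at hq
  · exact lt_of_not_ge fun hle => hqne (transfer_active_eq G wb wa m t x a ht haff hq (by simpa using hle))

end pattern

/-! ## The stub -/

/-- **STUB 3 · `stub_transfer`** — counter + C⁺ ⇒ `2^K` lower vertices at quasi-polynomial size (registered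
signature).  Near each supporting slope `μ_D` (margin of the strict inequalities over the finitely many
competitors) `counterVal K` is affine with slope `−X2 D D`, hence so is `patternVal` (slope `−X2 D D + d`), so
every point of the value set active at `μ_D` has abscissa `X2 D D − d`: the active point is unique, strictly
supported, and distinct `D` give distinct abscissae (`X2 D D = 2·sdot D`, ternary digits). -/
theorem stub_transfer
    (hcounter : ∀ (K : ℕ) (D : Fin K → Bool), ∃ μ : ℤ, |μ| ≤ 3 ^ (K + 1) ∧
      ∀ α β : Fin K → Bool, (α, β) ≠ (D, D) → Y4 D D - μ * X2 D D < Y4 α β - μ * X2 α β)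
    (hEF : ∃ k : ℕ, ∀ K : ℕ, ∃ N : ℕ, N ≤ 2 ^ ((Nat.log 2 K + k) ^ k) ∧
      ∃ (G : Finset (Fin N × Fin N)) (wb wa : Fin N → Fin N → ℝ) (c d : ℝ),
        (∃ ρ : Equiv.Perm (Fin N), ∀ u, (u, ρ u) ∈ G) ∧
        ∀ μ : ℝ, |μ| ≤ (3 : ℝ) ^ (K + 2) → patternVal G wb wa μ = counterVal K μ + c + d * μ) :
    ∃ k : ℕ, ∀ K : ℕ, ∃ N : ℕ, N ≤ 2 ^ ((Nat.log 2 K + k) ^ k) ∧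
      ∃ (G : Finset (Fin N × Fin N)) (wb wa : Fin N → Fin N → ℝ),
        2 ^ K ≤ (lowerVertices (valueSet G wb wa)).ncard := by
  obtain ⟨k, hk⟩ := hEF
  refine ⟨k, fun K => ?_⟩
  obtain ⟨N, hN, G, wb, wa, c, d, hne, hval⟩ := hk K
  refine ⟨N, hN, G, wb, wa, ?_⟩
  choose μD hμDb hμDm using hcounter K
  -- the candidate lower vertices
  set P : (Fin K → Bool) → ℝ × ℝ := fun D => ((X2 D D : ℝ) - d, (Y4 D D : ℝ) + c) with hP
  have ht : (0 : ℝ) < 1 / (4 * 3 ^ K) := by positivity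
  have hmem : ∀ D, P D ∈ lowerVertices (valueSet G wb wa) := by
    intro D
    refine transfer_mem_lowerVertices G wb wa hne (μD D) (1 / (4 * 3 ^ K)) _ _ ht fun μ hμ => ?_
    have hwin : |μ| ≤ (3 : ℝ) ^ (K + 2) := by
      have hb : |((μD D : ℤ) : ℝ)| ≤ 3 ^ (K + 1) := by exact_mod_cast hμDb D
      have ht1 : 1 / (4 * 3 ^ K) ≤ (1 : ℝ) := by
        rw [div_le_one (by positivity)]
        have : (1 : ℝ) ≤ 3 ^ K := one_le_pow₀ (by norm_num)
        linarith
      have h3 : (1 : ℝ) ≤ 3 ^ (K + 1) := one_le_pow₀ (by norm_num)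
      have hpow : (3 : ℝ) ^ (K + 2) = 3 * 3 ^ (K + 1) := by ring
      calc |μ| = |(μ - μD D) + μD D| := by rw [sub_add_cancel]
        _ ≤ |μ - μD D| + |((μD D : ℤ) : ℝ)| := abs_add_le _ _
        _ ≤ 1 + 3 ^ (K + 1) := add_le_add (hμ.trans ht1) hb
        _ ≤ 3 ^ (K + 2) := by rw [hpow]; linarith
    rw [hval μ hwin, transfer_counterVal_eq D (μD D) (hμDm D) μ hμ]
    ring
  have hinj : Function.Injective P := by
    intro D D' h
    have h1 : (X2 D D : ℝ) - d = X2 D' D' - d := congrArg Prod.fst h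
    have h2 : (X2 D D : ℝ) = X2 D' D' := by linarith
    have h3 : X2 D D = X2 D' D' := by exact_mod_cast h2
    unfold X2 at h3
    exact transfer_sdot_injective D D' (by linarith)
  have hfin : (lowerVertices (valueSet G wb wa)).Finite :=
    (transfer_valueSet_finite G wb wa).subset (lowerVertices_subset _)
  calc 2 ^ K = Nat.card (Fin K → Bool) := by simp
    _ = (Set.range P).ncard := (Set.ncard_range_of_injective hinj).symm
    _ ≤ (lowerVertices (valueSet G wb wa)).ncard :=
        Set.ncard_le_ncard (Set.range_subset_iff.2 hmem) hfin

end Summit.ValiantsHypothesis.ValiantsHypothesis.Theorems.DivisionGapShadowBirkhoff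

end
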